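import Summits.CriticalPhenomena.PercolationContinuityZ3.Theorems.SubpolynomialBlocking.Negative.OffCritical
import Literature.Probability.Percolation.ConstrainedClusters
import Literature.Probability.Percolation.HalfSpaceBrickSymmetry
import Literature.Probability.Percolation.HalfSpaceBrickUp
import Literature.Probability.Percolation.FiniteEnergy
import HarnessLib

/-!
# `SubpolynomialBlocking` — sub-surface-order floor, part I: closing the out-edges of the active sites

Support file for crux item stmt-CriticalPhenomena-4446 (`PercNonProliferation.SubpolynomialBlocking`:
`∀ s > 0, ∀ᶠ n, n^{-s} ≤ u_n`, `u_n = blockProb 3 p_c n = P_{p_c(ℤ³)}(Λ_n ↮ ∂ⁱⁿΛ_{2n} inside Λ_{2n})`), line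
`slab-ladder-two-curtains`, lead c2. Part I of the proof of the sub-surface-order floor
`∀ ε > 0, ∀ᶠ n, exp(-ε n²) ≤ u_n` (part II: `…SubpolynomialBlockingSubsurface.lean`). Valid in every
dimension `d` and at every `p < 1`:

* EXPLORATION FROM INSIDE. Let `m = 2n - 1`. A site `w ∈ ∂ⁱⁿΛ_m` is ACTIVE if it is joined inside `Λ_m` to
  the inner box `Λ_n = Λ_{m-(n-1)}`; `D_w` is the event "if `w` is active then every lattice edge from `w`
  out of `Λ_m` is closed". On lattice configurations `⋂_w D_w ⊆ {Λ_n ↮ ∂ⁱⁿΛ_{2n} inside Λ_{2n}}`: the first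
  exit edge from `Λ_m` of a crossing walk starts at an active site (`forall_D_subset_block`).
* HARRIS. Each `D_w` is decreasing, so `P(⋂_w D_w) ≥ ∏_w P(D_w)` (Grimmett 1999, Thm. (2.4)); by
  disjoint-support independence of "active" (edges inside `Λ_m`) and "out-edges closed" (edges leaving
  `Λ_m`), `P(D_w) = 1 - a_w + a_w (1-p)^{#out(w)} ≥ c^{a_w}` with `c = (1-p)^{2d}`, `a_w = P(w active)`
  (Bernoulli's inequality). Hence `u_n ≥ c^{Σ_w a_w}` (`subsurfaceHarris`).

Part II bounds `a_w` by the half-space one-arm probability (Cerf–Dembin symmetry) and feeds in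
Barsky–Grimmett–Newman. References: G. Grimmett, Percolation (1999), §1.3, §2.2, Thm. (7.35).
-/

noncomputable section

namespace Summit.CriticalPhenomena.PercolationContinuityZ3.Theorems.SubpolynomialBlocking

open MeasureTheory Filter Topology
open Literature.Probability.Percolation Literature.Probability.LatticeModels
open Literature.Probability.Percolation.DCT16
open Literature.Barriers.CriticalPhenomena
open Summit.CriticalPhenomena.PercolationContinuityZ3.Theorems.SubpolynomialBlocking.Negative

namespace Subsurface

variable {d : ℕ}

/-! ## §2 The events "active" and "out-edges closed": locality, monotonicity, measurability -/

/-- The event "`w` is active" is determined by the edges of the step graph inside `Λ_m`. -/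
theorem determinedBy_active (m t : ℕ) (w : Site d) :
    DeterminedBy {ω : BondConfig (Site d) | ∃ x ∈ box d (m - t),
        ω ∈ openConnVia (withinGraph (zdGraph d) ↑(box d m)) w x}
      (withinGraph (zdGraph d) ↑(box d m)).edgeSet := by
  rw [determinedBy_iff]
  intro ω ω' h
  simp only [Set.mem_setOf_eq]
  refine exists_congr fun x => and_congr_right fun _ => ?_
  exact (determinedBy_iff _ _).1 (determinedBy_openConnVia _ w x) ω ω' h

/-- The event "`w` is active" is measurable. -/
theorem measurableSet_active (m t : ℕ) (w : Site d) :
    MeasurableSet {ω : BondConfig (Site d) | ∃ x ∈ box d (m - t),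
        ω ∈ openConnVia (withinGraph (zdGraph d) ↑(box d m)) w x} := by
  have h : {ω : BondConfig (Site d) | ∃ x ∈ box d (m - t),
      ω ∈ openConnVia (withinGraph (zdGraph d) ↑(box d m)) w x} =
        ⋃ x ∈ box d (m - t), openConnVia (withinGraph (zdGraph d) ↑(box d m)) w x := by
    ext ω; simp
  rw [h]
  exact Finset.measurableSet_biUnion _ fun x _ => measurableSet_openConnVia _ w x

/-- The event "`w` is active" is increasing. -/
theorem isUpperSet_active (m t : ℕ) (w : Site d) :
    IsUpperSet {ω : BondConfig (Site d) | ∃ x ∈ box d (m - t),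
        ω ∈ openConnVia (withinGraph (zdGraph d) ↑(box d m)) w x} := by
  rintro ω ω' hle ⟨x, hx, hω⟩
  exact ⟨x, hx, openClusterIn_mono_config _ hle w hω⟩

/-- The out-edges of `w` (edges of `∂_E Λ_m` containing `w`) are lattice edges. -/
theorem coe_outEdges_subset_edgeSet (m : ℕ) (w : Site d) :
    (↑((edgeBoundary (zdGraph d) (box d m)).filter fun e => w ∈ e) : Set (Sym2 (Site d))) ⊆
      (zdGraph d).edgeSet := fun _ he =>
  (mem_edgeBoundary_iff.1 (Finset.mem_filter.1 (Finset.mem_coe.1 he)).1).1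

/-- The out-edges of `w` are disjoint from the edges of the step graph inside `Λ_m` (they have an
endpoint outside `Λ_m`). -/
theorem disjoint_edgeSet_withinGraph_outEdges (m : ℕ) (w : Site d) :
    Disjoint (withinGraph (zdGraph d) ↑(box d m)).edgeSet
      (↑((edgeBoundary (zdGraph d) (box d m)).filter fun e => w ∈ e) : Set (Sym2 (Site d))) := by
  rw [Set.disjoint_left]
  intro e he he'
  obtain ⟨-, -, y, hy, hye⟩ := mem_edgeBoundary_iff.1 (Finset.mem_filter.1 (Finset.mem_coe.1 he')).1
  induction e using Sym2.ind with
  | h u v =>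
    have huv : (withinGraph (zdGraph d) ↑(box d m)).Adj u v := he
    rcases Sym2.mem_iff.1 hye with rfl | rfl
    · exact hy (Finset.mem_coe.1 huv.2.1)
    · exact hy (Finset.mem_coe.1 huv.2.2)

/-- A site has at most `2d` out-edges (they are among its `2d` incident lattice edges). -/
theorem card_outEdges_le (m : ℕ) (w : Site d) :
    ((edgeBoundary (zdGraph d) (box d m)).filter fun e => w ∈ e).card ≤ 2 * d := by
  classical
  calc ((edgeBoundary (zdGraph d) (box d m)).filter fun e => w ∈ e).card
      ≤ ((zdGraph d).incidenceFinset w).card := by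
        refine Finset.card_le_card fun e he => ?_
        obtain ⟨he, hwe⟩ := Finset.mem_filter.1 he
        exact ((zdGraph d).mem_incidenceFinset w e).2 ⟨(mem_edgeBoundary_iff.1 he).1, hwe⟩
    _ = ((zdGraph d).neighborFinset w).card := by
        rw [SimpleGraph.card_incidenceFinset_eq_degree, SimpleGraph.card_neighborFinset_eq_degree]
    _ = 2 * d := card_neighborFinset_zdGraph_holds w
    _ ≤ 2 * d := le_rfl

/-- **`P_p(D_w) ≥ c^{a_w}`** with `c = (1-p)^{2d}`, `a_w = P_p(w active)`: `D_w = (active)ᶜ ⊔ (active ∩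
{out-edges closed})`, the two pieces are disjoint, the second factorises by disjoint-support independence
(`bondPercolation_real_inter_of_disjoint`), `P(out-edges closed) = (1-p)^{#out} ≥ c`, and
`1 - a + a c ≥ c^a` is Bernoulli's inequality (`Real.rpow_one_add_le_one_add_mul_self`). -/
theorem rpow_le_real_D (p : unitInterval) (hp1 : (p : ℝ) < 1) (m t : ℕ) (w : Site d) :
    ((1 - (p : ℝ)) ^ (2 * d)) ^ (bondPercolation (zdGraph d) p).real
        {ω | ∃ x ∈ box d (m - t), ω ∈ openConnVia (withinGraph (zdGraph d) ↑(box d m)) w x} ≤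
      (bondPercolation (zdGraph d) p).real
        ({ω | ∃ x ∈ box d (m - t), ω ∈ openConnVia (withinGraph (zdGraph d) ↑(box d m)) w x}ᶜ ∪
          ({ω | ∃ x ∈ box d (m - t), ω ∈ openConnVia (withinGraph (zdGraph d) ↑(box d m)) w x} ∩
            {ω | ∀ e ∈ (edgeBoundary (zdGraph d) (box d m)).filter (fun e => w ∈ e), e ∉ ω})) := by
  classical
  set A : Set (BondConfig (Site d)) := {ω | ∃ x ∈ box d (m - t),
    ω ∈ openConnVia (withinGraph (zdGraph d) ↑(box d m)) w x} with hA
  set F : Finset (Sym2 (Site d)) := (edgeBoundary (zdGraph d) (box d m)).filter fun e => w ∈ e with hF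
  set C : Set (BondConfig (Site d)) := {ω | ∀ e ∈ F, e ∉ ω} with hC
  set μ := bondPercolation (zdGraph d) p with hμ
  set a : ℝ := μ.real A with ha
  set c : ℝ := (1 - (p : ℝ)) ^ (2 * d) with hc
  have hq0 : 0 < 1 - (p : ℝ) := by linarith
  have hq1 : 1 - (p : ℝ) ≤ 1 := by linarith [p.2.1]
  have hc0 : 0 < c := pow_pos hq0 _
  have ha0 : 0 ≤ a := measureReal_nonneg
  have ha1 : a ≤ 1 := measureReal_le_one
  have hAm : MeasurableSet A := measurableSet_active m t w
  have hCm : MeasurableSet C := measurableSet_forall_notMem F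
  -- `P(C) = (1-p)^{|F|} ≥ c`
  have hCeq : μ.real C = (1 - (p : ℝ)) ^ F.card :=
    BGN.bondPercolation_real_forall_notMem_eq (zdGraph d) p F (coe_outEdges_subset_edgeSet m w)
  have hCge : c ≤ μ.real C := by
    rw [hCeq, hc]
    exact pow_le_pow_of_le_one hq0.le hq1 (card_outEdges_le m w)
  -- independence of `A` (inside edges) and `C` (out-edges)
  have hAC : μ.real (A ∩ C) = a * μ.real C :=
    bondPercolation_real_inter_of_disjoint (zdGraph d) p (disjoint_edgeSet_withinGraph_outEdges m w)
      (determinedBy_active m t w) (determinedBy_forall_notMem F) hAm hCm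
  -- disjoint union
  have hdisj : Disjoint Aᶜ (A ∩ C) := Set.disjoint_left.2 fun ω hω hω' => hω hω'.1
  have hunion : μ.real (Aᶜ ∪ (A ∩ C)) = μ.real Aᶜ + μ.real (A ∩ C) :=
    measureReal_union hdisj (hAm.inter hCm)
  have hcompl : μ.real Aᶜ = 1 - a := probReal_compl_eq_one_sub hAm
  -- Bernoulli: `c^a = (1 + (c-1))^a ≤ 1 + a (c-1)`
  have hbern : c ^ a ≤ 1 + a * (c - 1) := by
    have h := rpow_one_add_le_one_add_mul_self (show (-1 : ℝ) ≤ c - 1 by linarith) ha0 ha1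
    rwa [add_sub_cancel] at h
  calc c ^ a ≤ 1 + a * (c - 1) := hbern
    _ = (1 - a) + a * c := by ring
    _ ≤ (1 - a) + a * μ.real C := by gcongr
    _ = μ.real (Aᶜ ∪ (A ∩ C)) := by rw [hunion, hcompl, hAC]

/-- `D_w` is decreasing. -/
theorem isLowerSet_D (m t : ℕ) (w : Site d) :
    IsLowerSet ({ω : BondConfig (Site d) | ∃ x ∈ box d (m - t),
          ω ∈ openConnVia (withinGraph (zdGraph d) ↑(box d m)) w x}ᶜ ∪
        ({ω | ∃ x ∈ box d (m - t), ω ∈ openConnVia (withinGraph (zdGraph d) ↑(box d m)) w x} ∩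
          {ω | ∀ e ∈ (edgeBoundary (zdGraph d) (box d m)).filter (fun e => w ∈ e), e ∉ ω})) := by
  intro ω ω' hle hω
  rcases hω with hω | ⟨-, hωC⟩
  · exact Or.inl fun h' => hω (isUpperSet_active m t w hle h')
  · by_cases hA : ω' ∈ {ω : BondConfig (Site d) | ∃ x ∈ box d (m - t),
        ω ∈ openConnVia (withinGraph (zdGraph d) ↑(box d m)) w x}
    · exact Or.inr ⟨hA, fun e he heω => hωC e he (hle heω)⟩
    · exact Or.inl hA

/-- `D_w` is measurable. -/
theorem measurableSet_D (m t : ℕ) (w : Site d) :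
    MeasurableSet ({ω : BondConfig (Site d) | ∃ x ∈ box d (m - t),
          ω ∈ openConnVia (withinGraph (zdGraph d) ↑(box d m)) w x}ᶜ ∪
        ({ω | ∃ x ∈ box d (m - t), ω ∈ openConnVia (withinGraph (zdGraph d) ↑(box d m)) w x} ∩
          {ω | ∀ e ∈ (edgeBoundary (zdGraph d) (box d m)).filter (fun e => w ∈ e), e ∉ ω})) :=
  (measurableSet_active m t w).compl.union
    ((measurableSet_active m t w).inter (measurableSet_forall_notMem _))

/-! ## §3 The deterministic step: closing the out-edges of the active sites blocks the annulus -/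

/-- **`⋂_{w ∈ ∂ⁱⁿΛ_{2n-1}} D_w ⊆ {Λ_n ↮ ∂ⁱⁿΛ_{2n} inside Λ_{2n}}` on lattice configurations** (`n ≥ 1`,
`m = 2n-1`, `t = n-1`, so `Λ_{m-t} = Λ_n`): an open path from `Λ_n` to `∂ⁱⁿΛ_{2n}` inside `Λ_{2n}` leaves
`Λ_m` (its endpoint has a coordinate `±2n`); its first exit edge `{a, b}`, `a ∈ Λ_m`, `b ∉ Λ_m`, starts at a
site `a ∈ ∂ⁱⁿΛ_m` which is ACTIVE (the initial segment joins it inside `Λ_m` to the starting point in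
`Λ_n`) and is an out-edge of `a`, hence closed on `D_a` — but it is open. -/
theorem forall_D_subset_block {n : ℕ} (hn : 1 ≤ n) {ω : BondConfig (Site d)}
    (hω : ω ⊆ (zdGraph d).edgeSet)
    (hD : ∀ w ∈ innerBoundary (zdGraph d) (box d (2 * n - 1)),
      ω ∈ ({ω : BondConfig (Site d) | ∃ x ∈ box d (2 * n - 1 - (n - 1)),
          ω ∈ openConnVia (withinGraph (zdGraph d) ↑(box d (2 * n - 1))) w x}ᶜ ∪
        ({ω | ∃ x ∈ box d (2 * n - 1 - (n - 1)),
            ω ∈ openConnVia (withinGraph (zdGraph d) ↑(box d (2 * n - 1))) w x} ∩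
          {ω | ∀ e ∈ (edgeBoundary (zdGraph d) (box d (2 * n - 1))).filter (fun e => w ∈ e),
            e ∉ ω}))) :
    ω ∈ (annulusCrossing d n)ᶜ := by
  rintro ⟨x, hx, y, hy, hxy⟩
  set m : ℕ := 2 * n - 1 with hm
  have hmn : m - (n - 1) = n := by omega
  have hnm : n ≤ m := by omega
  have hpath := DCT16.mem_openConnIn_iff_pathIn.1 hxy
  -- `y ∉ Λ_m`, `x ∈ Λ_m`
  have hym : y ∉ (↑(box d m) : Set (Site d)) := by
    intro hym
    obtain ⟨i, hi⟩ := exists_eq_of_mem_innerBoundary_box hy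
    have h1 := (mem_box.1 (Finset.mem_coe.1 hym)) i
    push_cast at hi h1
    omega
  have hxm : x ∈ (↑(box d m) : Set (Site d)) := Finset.mem_coe.2 (box_mono d hnm hx)
  obtain ⟨a, b, ha, hb, -, hab, hxa⟩ := hpath.exit (R := (↑(box d m) : Set (Site d))) hxm hym
  have he : s(a, b) ∈ ω := ((openGraph_adj ω a b).1 hab).1
  have hadj : (zdGraph d).Adj a b := hω he
  have ha' : a ∈ box d m := Finset.mem_coe.1 ha
  have hb' : b ∉ box d m := fun h => hb (Finset.mem_coe.2 h)
  have haB : a ∈ innerBoundary (zdGraph d) (box d m) := mem_innerBoundary_iff.2 ⟨ha', b, hb', hadj⟩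
  -- `a` is active, witnessed by `x ∈ Λ_n = Λ_{m-(n-1)}`
  have hact : ω ∈ {ω : BondConfig (Site d) | ∃ x ∈ box d (m - (n - 1)),
      ω ∈ openConnVia (withinGraph (zdGraph d) ↑(box d m)) a x} := by
    refine ⟨x, by rw [hmn]; exact hx, ?_⟩
    have hxa' : PathIn (openGraph ω) (↑(box d m) : Set (Site d)) x a :=
      hxa.mono (Set.inter_subset_left)
    have h1 : ω ∈ openConnIn (↑(box d m) : Set (Site d)) x a := mem_openConnIn_of_pathIn hxa'
    rw [openConnIn_eq_openConnVia hxm] at h1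
    have h2 : a ∈ openClusterIn (withinGraph (zdGraph d) ↑(box d m)) ω x := by
      rw [openClusterIn_withinGraph_eq_top (zdGraph d) (↑(box d m) : Set (Site d)) hω]; exact h1
    change x ∈ openClusterIn (withinGraph (zdGraph d) ↑(box d m)) ω a
    rw [mem_openClusterIn_iff] at h2 ⊢
    exact h2.symm
  -- so its out-edges are closed, in particular `{a, b}`
  rcases hD a haB with hna | ⟨-, hC⟩
  · exact hna hact
  · refine hC (s(a, b)) ?_ he
    refine Finset.mem_filter.2 ⟨mem_edgeBoundary_iff.2 ⟨hadj, ⟨a, ha', Sym2.mem_mk_left _ _⟩,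
      ⟨b, hb', Sym2.mem_mk_right _ _⟩⟩, Sym2.mem_mk_left _ _⟩

/-! ## §4 The probabilistic assembly -/

/-- **`u_n ≥ c^{Σ_w a_w}`** (`n ≥ 1`, `p < 1`, `c = (1-p)^{2d}`, the sum over `w ∈ ∂ⁱⁿΛ_{2n-1}` of the
activity probabilities): `u_n ≥ P(⋂_w D_w)` (`forall_D_subset_block`, up to the null set of non-lattice
configurations) `≥ ∏_w P(D_w)` (Harris–FKG for the decreasing `D_w`, `prob_biInter_ge_prod_of_isLowerSet`)
`≥ ∏_w c^{a_w} = c^{Σ_w a_w}` (`rpow_le_real_D`, `Real.rpow_sum_of_pos`). -/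
theorem blockProb_ge_rpow_sum (p : unitInterval) (hp1 : (p : ℝ) < 1) {n : ℕ} (hn : 1 ≤ n) :
    ((1 - (p : ℝ)) ^ (2 * d)) ^ (∑ w ∈ innerBoundary (zdGraph d) (box d (2 * n - 1)),
        (bondPercolation (zdGraph d) p).real {ω | ∃ x ∈ box d (2 * n - 1 - (n - 1)),
          ω ∈ openConnVia (withinGraph (zdGraph d) ↑(box d (2 * n - 1))) w x}) ≤
      blockProb d p n := by
  classical
  set m : ℕ := 2 * n - 1 with hm
  set c : ℝ := (1 - (p : ℝ)) ^ (2 * d) with hc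
  have hc0 : 0 < c := pow_pos (by linarith) _
  set D : Site d → Set (BondConfig (Site d)) := fun w =>
    {ω : BondConfig (Site d) | ∃ x ∈ box d (m - (n - 1)),
        ω ∈ openConnVia (withinGraph (zdGraph d) ↑(box d m)) w x}ᶜ ∪
      ({ω | ∃ x ∈ box d (m - (n - 1)), ω ∈ openConnVia (withinGraph (zdGraph d) ↑(box d m)) w x} ∩
        {ω | ∀ e ∈ (edgeBoundary (zdGraph d) (box d m)).filter (fun e => w ∈ e), e ∉ ω}) with hDdef
  have h1 : ∏ w ∈ innerBoundary (zdGraph d) (box d m), (bondPercolation (zdGraph d) p).real (D w) ≤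
      (bondPercolation (zdGraph d) p).real (⋂ w ∈ innerBoundary (zdGraph d) (box d m), D w) :=
    prob_biInter_ge_prod_of_isLowerSet (zdGraph d) p _ D (fun w _ => isLowerSet_D m (n - 1) w)
      (fun w _ => measurableSet_D m (n - 1) w)
  have h2 : (bondPercolation (zdGraph d) p).real (⋂ w ∈ innerBoundary (zdGraph d) (box d m), D w) ≤
      blockProb d p n :=
    real_mono_of_forall_subset_edgeSet (zdGraph d) p fun ω hω hωD =>
      forall_D_subset_block hn hω fun w hw => (Set.mem_iInter₂.1 hωD) w hw
  have h3 : ∏ w ∈ innerBoundary (zdGraph d) (box d m),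
      c ^ (bondPercolation (zdGraph d) p).real {ω | ∃ x ∈ box d (m - (n - 1)),
          ω ∈ openConnVia (withinGraph (zdGraph d) ↑(box d m)) w x} ≤
        ∏ w ∈ innerBoundary (zdGraph d) (box d m), (bondPercolation (zdGraph d) p).real (D w) :=
    Finset.prod_le_prod (fun w _ => Real.rpow_nonneg hc0.le _)
      fun w _ => rpow_le_real_D p hp1 m (n - 1) w
  rw [Real.rpow_sum_of_pos hc0]
  exact h3.trans (h1.trans h2)

end Subsurface

/-- **`u_n ≥ c^{Σ_w a_w}`, registered form** (stub `subsurfaceHarris` on crux stmt-CriticalPhenomena-4446, line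
`slab-ladder-two-curtains`, lead c2): for every `d`, every `p < 1` and `n ≥ 1`, the annulus-blocking
probability `u_n(d,p) = Negative.blockProb d p n` is at least `((1-p)^{2d})^{Σ_{w ∈ ∂ⁱⁿΛ_{2n-1}} P_p(w active)}`,
where `w` is active when it is joined inside `Λ_{2n-1}` to `Λ_n` (`Subsurface.blockProb_ge_rpow_sum`). -/
theorem subsurfaceHarris :
    ∀ (d : ℕ) (p : unitInterval), (p : ℝ) < 1 → ∀ n : ℕ, 1 ≤ n →
      ((1 - (p : ℝ)) ^ (2 * d)) ^ (∑ w ∈ innerBoundary (zdGraph d) (box d (2 * n - 1)),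
          (bondPercolation (zdGraph d) p).real {ω | ∃ x ∈ box d (2 * n - 1 - (n - 1)),
            ω ∈ openConnVia (withinGraph (zdGraph d) ↑(box d (2 * n - 1))) w x}) ≤
        Negative.blockProb d p n :=
  fun _ p hp1 _ hn => Subsurface.blockProb_ge_rpow_sum p hp1 hn

end Summit.CriticalPhenomena.PercolationContinuityZ3.Theorems.SubpolynomialBlocking

end
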